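import Summits.Ventures.GridStability.Models.WSCC9DroopQVHurwitz
import Summits.Ventures.GridStability.Models.NE39DroopQVHurwitz

/-!
# GridStability/Models/DroopQVSimpleZeroInstances — the rotation zero is ALGEBRAICALLY SIMPLE for the constructions «DROOPQV-WSCC9» (9 states) and «DROOPQV-NE39» (30 states): no Jordan chain at `0`

Cell `gridfusion` (LADDER-GRIDFUSION, APEX LINE rung G3.b; seat gridfusion-model-8 (g0); lead g6 RULING 7c (1): instance corollaries accompanying
`DroopMicrogrid.no_jordan_chain_at_zero_of_hessQ` (`Models/DroopQVPortHamiltonianStrict.lean` §3) — so that ref-3 can re-stamp «#51″ HURWITZ»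
and «#68-NE39-STRICT» from EIGENSPACE to SIMPLE ZERO). For both lossless constructions the structural lemma applies with NO new certificate (it
needs only the factorisation hypotheses, strict dissipation weights and the symmetry of `𝒬`, all discharged from the typed gains and the landed
symmetry facts): `WSCC9.droopQV_no_jordan_chain_at_zero`, `NE39.droopQV_no_jordan_chain_at_zero` — NO complex `w` with `J w = [1; 0; 0]`.
Together with `WSCC9.droopQV_eig_re_neg_or_rotation` / `NE39.droopQV_eig_re_neg_or_rotation` (`ker J = ℂ·r`, every other mode `Re μ < 0`):
the `3n × 3n` Jacobian at the rest point has a SIMPLE eigenvalue `0` (the rotation) and all other eigenvalues in the open left half-plane.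
THREE COLUMNS. CERTIFIED (kernel): matrix statements about the MODELS `WSCC9.droopQV.toMicrogrid` / `NE39.droopQV.toMicrogrid`. MODELLED: MV-6N —
SYNTHETIC/CONSTRUCTION (as in p519344 / p523381). VALIDATED: nothing. No sentence of this file says a grid, a microgrid or a converter is stable.
-/

noncomputable section

open Real Matrix Finset
open scoped ComplexOrder

namespace Summit.Ventures.GridStability.Models

namespace WSCC9

/-- **No Jordan chain at the rotation zero for «DROOPQV-WSCC9»**: no complex `w` solves `jacMatrix (θ*, V*) w = [1; 0; 0]`. CERTIFIED
(structural lemma + typed gains; no certificate needed). MODELLED: MV-6N — SYNTHETIC/CONSTRUCTION. No stability sentence. [folklore] -/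
theorem droopQV_no_jordan_chain_at_zero {w : Fin 3 ⊕ (Fin 3 ⊕ Fin 3) → ℂ}
    (hw : (droopQV.toMicrogrid.jacMatrix droopQV.angleOf droopQV.Vstar).map ((↑) : ℝ → ℂ) *ᵥ w
      = fun k => ((Sum.elim (fun _ => (1 : ℝ)) (Sum.elim 0 0) k : ℝ) : ℂ)) : False := by
  have hg := fun i => droopQV.toMicrogrid_gains i
  have hVq : ∀ i : Fin 3, 0 < droopQV.V i := by decide +kernel
  refine droopQV.toMicrogrid.no_jordan_chain_at_zero_of_hessQ _ _ (fun i => ?_) (fun i => ?_) (fun i => ?_)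
    (fun i => ?_) (fun i => ?_) (fun i => ?_) droopQV_hessQ_transpose 0 hw
  · rw [(hg i).2.2.1]; norm_num [droopQV]
  · rw [(hg i).1]; norm_num [droopQV]
  · rw [(hg i).2.2.2.1]; norm_num [droopQV]
  · change (droopQV.V i : ℝ) ≠ 0
    exact_mod_cast (hVq i).ne'
  · rw [(hg i).2.2.1, (hg i).1]; norm_num [droopQV]
  · rw [(hg i).2.2.2.1, (hg i).2.1]
    have := hVq i
    simp only [DroopQVData.Vstar]
    norm_num [droopQV]
    positivity

end WSCC9

namespace NE39

/-- **No Jordan chain at the rotation zero for «DROOPQV-NE39»** (30 states): no complex `w` solves `jacMatrix (θ*, V*) w = [1; 0; 0]`.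
CERTIFIED (structural lemma + typed gains). MODELLED: MV-6N — SYNTHETIC/CONSTRUCTION census object. No stability sentence. [folklore] -/
theorem droopQV_no_jordan_chain_at_zero {w : Fin 10 ⊕ (Fin 10 ⊕ Fin 10) → ℂ}
    (hw : (droopQV.toMicrogrid.jacMatrix droopQV.angleOf droopQV.Vstar).map ((↑) : ℝ → ℂ) *ᵥ w
      = fun k => ((Sum.elim (fun _ => (1 : ℝ)) (Sum.elim 0 0) k : ℝ) : ℂ)) : False := by
  have hg := fun i => droopQV.toMicrogrid_gains i
  have hVq : ∀ i : Fin 10, 0 < droopQV.V i := by decide +kernel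
  refine droopQV.toMicrogrid.no_jordan_chain_at_zero_of_hessQ _ _ (fun i => ?_) (fun i => ?_) (fun i => ?_)
    (fun i => ?_) (fun i => ?_) (fun i => ?_) (Matrix.ext fun a b => droopQV_hessQ_symm b a) 0 hw
  · rw [(hg i).2.2.1]; norm_num [droopQV]
  · rw [(hg i).1]; norm_num [droopQV]
  · rw [(hg i).2.2.2.1]; norm_num [droopQV]
  · change (droopQV.V i : ℝ) ≠ 0
    exact_mod_cast (hVq i).ne'
  · rw [(hg i).2.2.1, (hg i).1]; norm_num [droopQV]
  · rw [(hg i).2.2.2.1, (hg i).2.1]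
    have := hVq i
    simp only [DroopQVData.Vstar]
    norm_num [droopQV]
    positivity

end NE39

end Summit.Ventures.GridStability.Models

end
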